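import Summits.AtomisticToContinuum.HydrodynamicLimit.Theorems.LocalSecondLaw.Negative.Functional
import Summits.AtomisticToContinuum.HydrodynamicLimit.Theorems.StiffCollisionalRelaxationAssemblyColdCells
import Literature.MathematicalPhysics.KineticTheory.HardSphereEulerProofs
import Literature.MathematicalPhysics.KineticTheory.HardSphereUniformGas
import HarnessLib

/-!
# Pointwise floor of the coarse-grained entropy (refutation of `MeanSecondLaw`, stub P4)

Stub `P4` of the refutation line of the crux `AnnealedZeroHorizon.MeanSecondLaw`
(stmt-AtomisticToContinuum-9257).  For a configuration `w` of `N + 1` particles on the flat torus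
`T3`, a continuous probability kernel `k ≥ 0` and a diameter parameter `σ`, the crux's coarse-grained
entropy is `S(w) = ∫ₓ F(w, x) dx` with the UNGUARDED integrand
`F = -(R (3/2 log Θ - log R - f_ex(R σ³)))`, where `R = ρᵏ(x) = (N+1)⁻¹ Σᵢ k(x - xᵢ)`,
`Mv = (N+1)⁻¹ Σᵢ k(x - xᵢ) vᵢ`, `En = (N+1)⁻¹ Σᵢ k(x - xᵢ) |vᵢ|²/2` and
`Θ = (2/3)(En/R - |Mv|²/(2R²))` (Lean junk conventions: `x / 0 = 0`, `log 0 = 0`).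

We prove the deterministic floor `S(w) ≥ -1 - ke w`, `ke w = (N+1)⁻¹ Σᵢ |vᵢ|²/2`:
* pointwise in `x`, `F ≥ -1 - En` (`EntropyFloor.floor_scalar`): `R = 0` gives `F = 0`; for `R > 0`
  the Cauchy–Schwarz inequality `|Mv|² ≤ 2 R En` (the tree's
  `MacroBookkeeping.norm_sq_momentum_le`) gives `Θ ≥ 0`, and then `log Θ ≤ Θ`, `(3/2) R Θ ≤ En`,
  `R log R ≥ -1`, `f_ex ≥ 0`;
* `x ↦ -1 - En(w, x)` is continuous, hence integrable, with integral `-1 - ke w`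
  (translation invariance of Haar measure and `∫ k = 1`);
* if `F` is integrable, monotonicity of the integral concludes; otherwise the Bochner integral is the
  junk value `0 ≥ -1 - ke w`.

No definitions; helper lemmas live in the sub-namespace `EntropyFloor`.
-/

noncomputable section

namespace Summit.AtomisticToContinuum.HydrodynamicLimit.Theorems.MeanSecondLawRefutation

open MeasureTheory Filter Set Topology
open scoped ENNReal
open Literature.MathematicalPhysics.KineticTheory Literature.Analysis.FluidPDE
open LocalSecondLawNegative (ke)

namespace EntropyFloor

/-! ### The scalar inequality -/

/-- **Scalar floor.** For `a, e, m2 ≥ 0` with `m2 ≤ 2 a e` (Cauchy–Schwarz) the unguarded entropy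
density `-(a (3/2 log Θ - log a - f_ex(a σ³)))`, `Θ = (2/3)(e/a - m2/(2a²))`, is at least `-1 - e`
(junk conventions `x / 0 = 0`, `log 0 = 0` included). [folklore] -/
theorem floor_scalar (σ : ℝ) {a e m2 : ℝ} (ha : 0 ≤ a) (he : 0 ≤ e) (hm0 : 0 ≤ m2)
    (hm : m2 ≤ 2 * a * e) :
    -1 - e ≤ -(a * (3 / 2 * Real.log (2 / 3 * (e / a - m2 / (2 * a ^ 2))) - Real.log a -
      hsExcessFreeEnergy (a * σ ^ 3))) := by
  rcases ha.eq_or_lt with h0 | ha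
  · rw [← h0, zero_mul, neg_zero]
    linarith
  set b := 2 / 3 * (e / a - m2 / (2 * a ^ 2)) with hbdef
  have h1 : -1 ≤ a * Real.log a := LocalSecondLawNegative.mul_log_ge_neg_one ha
  have h2 : 0 ≤ a * hsExcessFreeEnergy (a * σ ^ 3) :=
    mul_nonneg ha.le (LocalSecondLawNegative.hsExcessFreeEnergy_nonneg _)
  have hb0 : 0 ≤ b := by
    have : m2 / (2 * a ^ 2) ≤ e / a := by
      rw [div_le_div_iff₀ (by positivity) ha]
      nlinarith
    rw [hbdef]
    linarith
  have h3 : Real.log b ≤ b := Real.log_le_self hb0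
  have h4 : a * b ≤ 2 / 3 * e := by
    have hab : a * b = 2 / 3 * (e - m2 / (2 * a)) := by
      rw [hbdef]
      field_simp
    rw [hab]
    have : 0 ≤ m2 / (2 * a) := by positivity
    nlinarith
  have h5 : a * Real.log b ≤ a * b := mul_le_mul_of_nonneg_left h3 ha.le
  nlinarith

/-! ### The energy field against a translated kernel -/

variable {N : ℕ}

/-- The translated-kernel energy field `x ↦ Eᵏ(x) = (N+1)⁻¹ Σᵢ k(x - xᵢ) |vᵢ|²/2` is continuous in
the field point for a continuous kernel. [folklore] -/
theorem continuous_energy {k : T3 → ℝ} (hk : Continuous k) (w : Config (N + 1) (Fin 3) T3) :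
    Continuous fun x => empiricalEnergyField w (fun y => k (x - y)) := by
  simp_rw [empiricalEnergyField_eq_sum]
  exact continuous_const.mul
    (continuous_finsetSum _ fun i _ => (hk.comp (continuous_sub_right _)).mul continuous_const)

/-- `∫ₓ Eᵏ(w, x) dx = ke w` for a continuous kernel of unit mass (translation invariance of the Haar
measure of `T3`). [folklore] -/
theorem integral_energy {k : T3 → ℝ} (hk : Continuous k) (hk1 : ∫ y, k y = 1)
    (w : Config (N + 1) (Fin 3) T3) :
    ∫ x, empiricalEnergyField w (fun y => k (x - y)) = ke w := by
  simp_rw [empiricalEnergyField_eq_sum]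
  rw [integral_const_mul,
    integral_finsetSum Finset.univ (f := fun i a => k (a - (w i).1) * (‖(w i).2‖ ^ 2 / 2))
      fun i _ => integrable_of_continuous_T3
        ((hk.comp (continuous_sub_right (w i).1)).mul continuous_const)]
  unfold LocalSecondLawNegative.ke
  congr 1
  refine Finset.sum_congr rfl fun i _ => ?_
  rw [integral_mul_const, integral_sub_right_eq_self (μ := volume) k (w i).1, hk1, one_mul]

/-- **Junk-robust lower bound of an integral.** If `G ≤ F` pointwise, `G` is integrable with
`∫ G = c ≤ 0`, then `c ≤ ∫ F` whether or not `F` is integrable (Bochner junk value `0`). [folklore] -/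
theorem le_integral_of_floor {F G : T3 → ℝ} {c : ℝ} (hG : Integrable G) (hGc : ∫ x, G x = c)
    (hc : c ≤ 0) (hFG : ∀ x, G x ≤ F x) : c ≤ ∫ x, F x := by
  by_cases hF : Integrable F
  · rw [← hGc]
    exact integral_mono hG hF hFG
  · rw [integral_undef hF]
    exact hc

end EntropyFloor

/-- **Pointwise floor of the coarse-grained mathematical entropy.** For every configuration `w` of
`N + 1` particles, every continuous probability kernel `k ≥ 0` and every `σ`, the crux's coarse entropy
`S(w) = ∫ η_σ(ρ^k, m^k, E^k)(x) dx` (UNGUARDED integrand, Lean junk conventions) is at least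
`−1 − (N+1)⁻¹ Σᵢ |vᵢ|²/2`: pointwise in `x` the integrand is `≥ −1 − E^k(x)` (`ρ f_ex ≥ 0`,
`ρ log ρ ≥ −1`, `log Θ ≤ Θ` with `Θ ≥ 0` by Cauchy–Schwarz, `R = 0 ⇒ 0`), `∫ E^k dx = ke`
(`∫ k(x − y) dx = 1`), and a non-integrable integrand only lifts `S` to `0 ≥ −1 − ke`. [folklore] -/
theorem entropyFloor {N : ℕ} (σ : ℝ) {k : T3 → ℝ} (hk : Continuous k) (hk0 : ∀ y, 0 ≤ k y)
    (hk1 : ∫ y, k y = 1) (w : Config (N + 1) (Fin 3) T3) :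
    -1 - ke w ≤
      ∫ x, (let R : ℝ := empiricalDensityField w (fun y => k (x - y)); let Mv : V3 := empiricalMomentumField w (fun y => k (x - y)); let En : ℝ := empiricalEnergyField w (fun y => k (x - y)); let Θ : ℝ := 2 / 3 * (En / R - ‖Mv‖ ^ 2 / (2 * R ^ 2)); -(R * (3 / 2 * Real.log Θ - Real.log R - hsExcessFreeEnergy (R * σ ^ 3)))) := by
  have hEi : Integrable fun x => empiricalEnergyField w (fun y => k (x - y)) :=
    integrable_of_continuous_T3 (EntropyFloor.continuous_energy hk w)
  have hG : Integrable fun x => -1 - empiricalEnergyField w (fun y => k (x - y)) :=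
    (integrable_const _).sub hEi
  have hGc : ∫ x, (-1 - empiricalEnergyField w (fun y => k (x - y))) = -1 - ke w := by
    rw [integral_sub (integrable_const _) hEi, integral_const, smul_eq_mul, probReal_univ, one_mul,
      EntropyFloor.integral_energy hk hk1 w]
  have hc : -1 - ke w ≤ 0 := by
    have := LocalSecondLawNegative.ke_nonneg w
    linarith
  refine EntropyFloor.le_integral_of_floor hG hGc hc fun x => ?_
  have hR : 0 ≤ empiricalDensityField w (fun y => k (x - y)) := by
    rw [empiricalDensityField_eq_sum]
    exact mul_nonneg (by positivity) (Finset.sum_nonneg fun i _ => hk0 _)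
  have hE : 0 ≤ empiricalEnergyField w (fun y => k (x - y)) := by
    rw [empiricalEnergyField_eq_sum]
    exact mul_nonneg (by positivity)
      (Finset.sum_nonneg fun i _ => mul_nonneg (hk0 _) (by positivity))
  dsimp only
  exact EntropyFloor.floor_scalar σ hR hE (sq_nonneg _)
    (MacroBookkeeping.norm_sq_momentum_le w fun y => hk0 _)

end Summit.AtomisticToContinuum.HydrodynamicLimit.Theorems.MeanSecondLawRefutation

end
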